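import Summits.BirchSwinnertonDyer.BirchSwinnertonDyer.Theorems.EisensteinPrimesBSDpOnCellCStubC3RoadHOther
import Summits.BirchSwinnertonDyer.BirchSwinnertonDyer.Theorems.SchneiderFreeAdditiveX3PoitouTateShaDualityHolds
import Summits.BirchSwinnertonDyer.BirchSwinnertonDyer.Theorems.SchneiderFreeAdditiveX3PoitouTateSelmerDualityHolds
import Literature.NumberTheory.EllipticCurves.BigRepModuleShapiroDualityProofs
import Literature.NumberTheory.EllipticCurves.Castella2018.AnticyclotomicSelmerDualModuleFinite
import HarnessLib

/-!
# Crux 4 `BSDpOnCellC` (stmt-BirchSwinnertonDyer-19034), line «telescope», leaf N2 sub-leaf W3, E-SIDE INPUT (I-E), FIRST HALF: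
# the STRICT (decomposition) big Selmer dual `X^{dec,∅}(E) = XBigDecomp κ (E[p^∞]) 𝔭̄ ∅` is finitely generated and `Λ`-torsion on Cell C,
# from the two refereed named facts GZK and «newform exists» (successor LEAD `cruxlead-19034` g3; `--supports`, helper; THEOREMS ONLY)

HONEST FRAMING. No stub, no crux, no summit statement proved; BSD is proved for no curve. CONDITIONAL on the two refereed named facts it takes as
hypotheses (`rank_eq_analyticRank_of_analyticRank_le_one` = Gross–Zagier–Kolyvagin, `exists_isNewformOf` = modularity), both conjuncts of the
telescope's cite stub `stub_publishedFacts` (hence available to leaf N2 after the v10 re-wording `stub_weightTwoControlOfPub`). This is the first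
half of the E-side input (I-E) of the LEAD's W3 kernel `TelescopeK2WeightTwoTransportOfInputs.weightTwoTransport_of_inputs` (which asks for the
UNRAMIFIED dual `XBig κ ρE 𝔭̄ ∅`); the second half — passing from `X^{dec,∅}` to `X^{unr,∅}` through the Σ-change at the primes `w ∣ N`
(tree `BigGaloisRep.XBigDecomp.isTorsion_and_charIdeal_mul_span_prod_le` + `JetchevSkinnerWan2017.sigmaLocal_dual_of_ne_zero`) and
`ℋ^{ur}_w = 0` at the good primes — is NOT in this file.

* **`moduleFinite_isTorsion_XBigDecomp_of_cellC`** — for a Cell C pair `(W, p)`, `K` imaginary quadratic with the Heegner hypothesis at `p`,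
  `L(E^{d_K}, 1) ≠ 0`, a non-torsion `P ∈ E(K)`, anticyclotomic `κ` with generator `γ`, `𝔭̄ ∋ p`, and ANY topology on `Λ` making `E[p^∞] ⊗ Λ^*`
  a topological module: `XBigDecomp κ ((W.baseChange K).primaryTorsionGaloisRep p) 𝔭̄ ∅` is finitely generated and torsion over `Λ = ℤ_p⟦T⟧`.
  Proof: `isTorsion_xAc_other_of_cellC` (tree; its Poitou–Tate hypotheses discharged by the tree theorems
  `SchneiderFreeAdditiveX3.PoitouTateReduction.poitouTate_selmerStructure_duality_holds` / `poitouTate_sha_tateDual_holds`) gives `X_ac` torsion;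
  `Castella2018.AcSelmer.XAc.module_finite_empty` gives `X_ac` finitely generated; Shapiro duality `SkinnerUrban2014.nonempty_linearEquiv_XAc_XBigDecomp`
  (`K` totally complex) transports both to `X^{dec,∅}`.

References: F. Castella, Camb. J. Math. 6 (2018) Thm. 2.3 first clause, Def. 2.2 [Castella2018]; Jetchev–Skinner–Wan, Camb. J. Math. 5 (2017) Thm. 3.3.1
[JetchevSkinnerWan2017]; Skinner–Urban, Invent. Math. 195 (2014) Prop. 3.2.3 [SkinnerUrban2014].
-/

set_option autoImplicit false
set_option linter.dupNamespace false

noncomputable section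

open scoped Classical

open WeierstrassCurve NumberField IsDedekindDomain Field PowerSeries
  Literature.NumberTheory.EllipticCurves Literature.NumberTheory.EllipticCurves.GreenbergSelmer
  Literature.NumberTheory.EllipticCurves.ModularForms
  Literature.NumberTheory.EllipticCurves.Rank1Residual
  Literature.NumberTheory.EllipticCurves.Rank1Residual.Typed
  Literature.NumberTheory.GaloisRepresentations Literature.NumberTheory.GaloisCohomology
  Literature.NumberTheory.EllipticCurves.BigGaloisRep
  Summit.BirchSwinnertonDyer.Rank1Residual.X11b.AcSelmer
  Summit.BirchSwinnertonDyer.Rank1Residual.X11b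
  Summit.BirchSwinnertonDyer.Rank1Residual.X2

namespace Summit.BirchSwinnertonDyer.BirchSwinnertonDyer.Theorems.TelescopeK2XBigDecompCellC

open Summit.BirchSwinnertonDyer.BirchSwinnertonDyer.Theorems

/-- **`X^{dec,∅}(E)` is finitely generated and `Λ`-torsion on Cell C, from GZK + modularity.** See the module docstring.
[cite: Castella2018, Thm. 2.3 (first clause) and Def. 2.2] [cite: SkinnerUrban2014, Prop. 3.2.3] -/
theorem moduleFinite_isTorsion_XBigDecomp_of_cellC
    (hGZK : rank_eq_analyticRank_of_analyticRank_le_one) (hnf : exists_isNewformOf)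
    {W : WeierstrassCurve ℚ} [W.IsElliptic] [W.IsGloballyMinimal] {p : ℕ} [Fact p.Prime]
    (hc : CellC W p) {K : Type} [Field K] [NumberField K] (hK : IsImaginaryQuadratic K)
    (hsplitK : SatisfiesHeegnerHypothesis p K)
    (hLt : (W.quadraticTwist (NumberField.discr K : ℚ)).entireLFunction 1 ≠ 0)
    (P : (W.baseChange K).toAffine.Point) (hPinf : ¬ IsOfFinAddOrder P)
    (κ : ZpExtension K p) (hκ : κ.IsAnticyclotomic) (γ : absoluteGaloisGroup K)
    [Fact (κ.IsTopGenerator γ)] (𝔭bar : HeightOneSpectrum (𝓞 K))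
    (h𝔭bar : ((p : ℕ) : 𝓞 K) ∈ 𝔭bar.asIdeal)
    [TopologicalSpace (PowerSeries ℤ_[p])]
    [ContinuousSMul (PowerSeries ℤ_[p]) (BigRepModule ℤ_[p] p (PrimaryTorsion (geomPoints (W.baseChange K)) p))] :
    Module.Finite (PowerSeries ℤ_[p])
        (XBigDecomp κ ((W.baseChange K).primaryTorsionGaloisRep p) 𝔭bar (∅ : Set (HeightOneSpectrum (𝓞 K)))) ∧
      Module.IsTorsion (PowerSeries ℤ_[p])
        (XBigDecomp κ ((W.baseChange K).primaryTorsionGaloisRep p) 𝔭bar (∅ : Set (HeightOneSpectrum (𝓞 K)))) := by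
  haveI : IsTotallyComplex K := hK.2
  -- `X_ac` is torsion (GZK + modularity + Poitou–Tate ×2, the latter tree theorems) and finitely generated
  have htor : Module.IsTorsion (IwasawaAlgebra p) (Castella2018.AcSelmer.XAc (W.baseChange K) p κ 𝔭bar ∅ γ) :=
    isTorsion_xAc_other_of_cellC hGZK hnf
      (fun L _ _ => SchneiderFreeAdditiveX3.PoitouTateReduction.poitouTate_selmerStructure_duality_holds L)
      (fun L _ _ => SchneiderFreeAdditiveX3.PoitouTateReduction.poitouTate_sha_tateDual_holds L)
      hc hK hsplitK hLt P hPinf κ hκ γ 𝔭bar h𝔭bar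
  haveI hfg : Module.Finite (IwasawaAlgebra p) (Castella2018.AcSelmer.XAc (W.baseChange K) p κ 𝔭bar ∅ γ) :=
    Castella2018.AcSelmer.XAc.module_finite_empty (W.baseChange K) p κ 𝔭bar γ
  -- Shapiro: `X_ac ≃ₗ[Λ] X^{dec,∅}`
  obtain ⟨e⟩ := SkinnerUrban2014.nonempty_linearEquiv_XAc_XBigDecomp (W.baseChange K) p κ 𝔭bar
    (∅ : Set (HeightOneSpectrum (𝓞 K))) γ
  refine ⟨Module.Finite.equiv e, fun x => ?_⟩
  obtain ⟨d, hd⟩ := @htor (e.symm x)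
  refine ⟨d, ?_⟩
  rw [Submonoid.smul_def, ← e.apply_symm_apply x, ← LinearEquiv.map_smul, ← Submonoid.smul_def, hd,
    LinearEquiv.map_zero]

end Summit.BirchSwinnertonDyer.BirchSwinnertonDyer.Theorems.TelescopeK2XBigDecompCellC

end
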